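import Literature.Analysis.FluidPDE.CKNEpsilonRegularityProofs
import HarnessLib

/-!
# Lemarié-Rieusset's Thm. 14.4: reduction to unit viscosity

Analysis/FluidPDE file in the decomposition of the named fact
`Literature.Analysis.FluidPDE.lemarieRieusset_epsilon_regularity` (Lemarié-Rieusset 2016,
Thm. 14.4). The accepted `lemarieRieusset_epsilon_regularity_iff_unitScale`
(`CKNEpsilonRegularityProofs`) reduces the theorem to `r₀ = 1`, keeping the viscosity `ν`; here
the viscosity is normalised:

* `lemarieRieusset_epsilon_regularity_nu_one` — the case `ν = 1`, `r₀ = 1` of Thm. 14.4, about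
  an arbitrary centre `z₀` (named statement);
* `lemarieRieusset_epsilon_regularity_of_nu_one` — **proved**: the case `ν = 1` implies the
  theorem.

## The proof

For `ν > 0` put `c = min(1, ν^{1/2})`, `α = c/ν`, `γ = c`, `β = αγ = c²/ν` and
`Φ(s, y) = (βs, γy)`. By the accepted `IsLRSuitableWeakSolutionOn.stRescale`, the datum
`(Φ⁻¹Ω, α²γ f∘Φ, α u∘Φ, α² p∘Φ, αγ G∘Φ)` satisfies the §14.3 hypotheses with viscosity
`αν/γ = 1`, and `Φ⁻¹(Q_1(0)) = (-1/β, 0) × B(0, 1/c) =: S`, a slab with `1/β ≥ 1`, `1/c ≥ 1`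
(`c² ≤ ν`, `c ≤ 1`). The smallness hypotheses transport with the Jacobian `(βγ³)⁻¹`:
`∫∫_S (|u'|³ + |p'|^{3/2}) ≤ α³ (βγ³)⁻¹ λ³` and `∫∫_S |f'|^q ≤ (α²γ)^q (βγ³)⁻¹ λ^{2q}`, both
`≤` the corresponding powers of `λ' = K λ`, `K = max((α³/(βγ³))^{1/3}, ((α²γ)^q/(βγ³))^{1/(2q)})`.
Every unit cylinder `Q_1(s', a') ⊆ S` therefore satisfies the hypotheses of the `ν = 1`
statement with `λ'` (as soon as `λ ≤ ε₁/K`), whence `|u'| ≤ C₁ K λ`, i.e.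
`|u ∘ Φ| ≤ C₁ K λ / α`, a.e. on `Q_{1/2}(s', a')`. The target `Φ⁻¹(Q_{1/2}(0)) =
(-1/(4β), 0) × B(0, 1/(2c))` is covered by countably many such half-cylinders: centres
`(s', a')` with `s'` rational in `[1 - 1/β, 0]` and `a'` in a countable dense set (or `0`) with
`|a'| + 1 ≤ 1/c` (for `(s, y)` in the target: `s' = 0` if `s > -1/4`, else a rational in
`(max(s, 1 - 1/β), s + 1/4)`, non-empty as `β ≤ 1`; `a' = 0` if `|y| < 1/2`, else a point of the
dense set in the open non-empty `B(y, 1/2) ∩ B(0, 1/c - 1)`, using `c ≤ 1`). The a.e. bound on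
the countable union transports back along `Φ` (`ae_restrict_of_ae_restrict_preimage_stAffine`)
with `C₀ = C₁ K / α`.

## References

* P. G. Lemarié-Rieusset, *The Navier–Stokes Problem in the 21st Century*, CRC Press (2016),
  Thm. 14.4 ("constants `ε₀` and `C₀` which depend only on `ν` and `q`"). [LemarieRieusset2016]
* L. Caffarelli, R. Kohn, L. Nirenberg, *Partial regularity of suitable weak solutions of the
  Navier–Stokes equations*, CPAM 35 (1982), §2 (scaling). [CaffarelliKohnNirenberg1982]
-/

noncomputable section

open MeasureTheory Set Function Filter Topology TopologicalSpace Metric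
open scoped NNReal ENNReal InnerProductSpace RealInnerProductSpace Laplacian

namespace Literature.Analysis.FluidPDE

/-- **Thm. 14.4 for unit viscosity at unit scale** (Lemarié-Rieusset 2016, Thm. 14.4, case
`ν = 1`, `r₀ = 1`, about an arbitrary centre `z₀ = (t₀, x₀)`): for `q > 5/2` there are
`ε₀, C₀ > 0` such that for every datum satisfying the §14.3 hypotheses
(`IsLRSuitableWeakSolutionOn`) with `ν = 1` on a domain `Ω ⊇ Q_1(z₀)` and every `0 ≤ λ ≤ ε₀`,
`∫∫_{Q_1(z₀)} (|u|³ + |p|^{3/2}) ≤ λ³` and `∫∫_{Q_1(z₀)} |f|^q ≤ λ^{2q}` imply `|u| ≤ C₀ λ` a.e. on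
`Q_{1/2}(z₀)`. [cite: LemarieRieusset2016, Thm. 14.4 p. 505, case ν = 1, r₀ = 1] -/
def lemarieRieusset_epsilon_regularity_nu_one : Prop :=
  ∀ q : ℝ, 5 / 2 < q → ∃ ε₀ C₀ : ℝ, 0 < ε₀ ∧ 0 < C₀ ∧
    ∀ (Ω : Opens (ℝ × EuclideanSpace ℝ (Fin 3)))
      (f u : ℝ → EuclideanSpace ℝ (Fin 3) → EuclideanSpace ℝ (Fin 3))
      (p : ℝ → EuclideanSpace ℝ (Fin 3) → ℝ)
      (G : ℝ → EuclideanSpace ℝ (Fin 3) → EuclideanSpace ℝ (Fin 3) →L[ℝ] EuclideanSpace ℝ (Fin 3)),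
      IsLRSuitableWeakSolutionOn Ω 1 q f u p G →
      ∀ (z₀ : ℝ × EuclideanSpace ℝ (Fin 3)) (l : ℝ),
        parabolicCylinder 1 z₀ ⊆ (Ω : Set (ℝ × EuclideanSpace ℝ (Fin 3))) → 0 ≤ l → l ≤ ε₀ →
        ∫⁻ w in parabolicCylinder 1 z₀,
            (‖u w.1 w.2‖ₑ ^ (3 : ℕ) + ‖p w.1 w.2‖ₑ ^ (3 / 2 : ℝ)) ≤ ENNReal.ofReal (l ^ 3) →
        ∫⁻ w in parabolicCylinder 1 z₀, ‖f w.1 w.2‖ₑ ^ q ≤ ENNReal.ofReal (l ^ (2 * q)) →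
        ∀ᵐ w ∂(volume.restrict (parabolicCylinder (1 / 2) z₀)), ‖u w.1 w.2‖ ≤ C₀ * l

/-- `(r²)^{3/2} = r³` for `r ≥ 0`. [folklore] -/
private theorem sq_rpow_three_halves' {r : ℝ} (hr : 0 ≤ r) : (r ^ 2) ^ (3 / 2 : ℝ) = r ^ 3 := by
  rw [← Real.rpow_natCast r 2, ← Real.rpow_mul hr, ← Real.rpow_natCast r 3]
  norm_num

/-- The spatial part of the covering: for `0 < c ≤ 1`, a point `y` with `|y| < 1/(2c)` lies in a
ball `B(a', 1/2)` with `|a'| + 1 ≤ 1/c` and `a'` in a prescribed dense set or `a' = 0`. [folklore] -/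
theorem exists_center_of_norm_lt {c : ℝ} (hc : 0 < c) (hc1 : c ≤ 1)
    {D : Set (EuclideanSpace ℝ (Fin 3))} (hD : Dense D) {y : EuclideanSpace ℝ (Fin 3)}
    (hy : ‖y‖ < 1 / (2 * c)) :
    ∃ a : EuclideanSpace ℝ (Fin 3), (a ∈ D ∨ a = 0) ∧ ‖a‖ + 1 ≤ 1 / c ∧ ‖y - a‖ < 1 / 2 := by
  by_cases hy2 : ‖y‖ < 1 / 2
  · refine ⟨0, Or.inr rfl, ?_, by simpa using hy2⟩
    rw [norm_zero, zero_add]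
    rw [le_div_iff₀ hc]; linarith
  · have hy2 : 1 / 2 ≤ ‖y‖ := not_lt.1 hy2
    have hc2 : 1 / (2 * c) ≤ 1 / c - 1 / 2 := by
      rw [div_le_iff₀ (by positivity), sub_mul, div_mul_eq_mul_div, one_mul,
        mul_div_assoc, div_self hc.ne']
      linarith
    -- an explicit admissible centre on the segment `[0, y]`
    set ρ : ℝ := (max (‖y‖ - 1 / c + 1) 0 + 1 / 2) / 2 with hρ
    have hρ1 : ρ < 1 / 2 := by
      have : max (‖y‖ - 1 / c + 1) 0 < 1 / 2 := max_lt (by linarith) (by norm_num)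
      rw [hρ]; linarith
    have hρ2 : ‖y‖ - 1 / c + 1 < ρ := by
      have := le_max_left (‖y‖ - 1 / c + 1) 0
      rw [hρ]; linarith [le_max_right (‖y‖ - 1 / c + 1) 0, hρ1]
    have hρ0 : 0 ≤ ρ := by rw [hρ]; positivity
    have hypos : 0 < ‖y‖ := lt_of_lt_of_le (by norm_num) hy2
    set a₀ : EuclideanSpace ℝ (Fin 3) := (1 - ρ / ‖y‖) • y with ha₀
    have hya₀ : ‖y - a₀‖ = ρ := by
      rw [ha₀, show y - (1 - ρ / ‖y‖) • y = (ρ / ‖y‖) • y by rw [sub_smul, one_smul]; abel,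
        norm_smul, Real.norm_eq_abs, abs_of_nonneg (by positivity), div_mul_cancel₀ _ hypos.ne']
    have ha₀n : ‖a₀‖ = ‖y‖ - ρ := by
      have h1 : 0 ≤ 1 - ρ / ‖y‖ := by
        rw [sub_nonneg, div_le_one hypos]; linarith
      rw [ha₀, norm_smul, Real.norm_eq_abs, abs_of_nonneg h1, sub_mul, one_mul,
        div_mul_cancel₀ _ hypos.ne']
    -- the open set of admissible centres near `y` is non-empty, hence meets `D`
    have hU : IsOpen (ball y (1 / 2) ∩ ball (0 : EuclideanSpace ℝ (Fin 3)) (1 / c - 1)) :=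
      isOpen_ball.inter isOpen_ball
    have hmem : a₀ ∈ ball y (1 / 2) ∩ ball (0 : EuclideanSpace ℝ (Fin 3)) (1 / c - 1) := by
      refine ⟨?_, ?_⟩
      · rw [mem_ball, dist_comm, dist_eq_norm, hya₀]; exact hρ1
      · rw [mem_ball, dist_zero_right, ha₀n]; linarith
    obtain ⟨a, ha1, ha2⟩ := hD.exists_mem_open hU ⟨a₀, hmem⟩  -- `Dense.exists_mem_open`
    refine ⟨a, Or.inl ha1, ?_, ?_⟩
    · have := (mem_ball.1 ha2.2)
      rw [dist_zero_right] at this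
      linarith
    · have := mem_ball.1 ha2.1
      rwa [dist_comm, dist_eq_norm] at this

set_option maxHeartbeats 800000 in
/-- **Thm. 14.4 follows from its case `ν = 1`** (normalisation of the viscosity by the
space–time scaling `u ↦ (c/ν) u(c² s/ν, c y)`, `c = min(1, ν^{1/2})`, and a countable covering
of the rescaled half-cylinder by unit-aspect half-cylinders; see the module docstring). [cite: LemarieRieusset2016, Thm. 14.4 p. 505] -/
theorem lemarieRieusset_epsilon_regularity_of_nu_one
    (h : lemarieRieusset_epsilon_regularity_nu_one) : lemarieRieusset_epsilon_regularity := by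
  rw [lemarieRieusset_epsilon_regularity_iff_unitScale]
  intro ν q hν hq
  obtain ⟨ε₁, C₁, hε₁, hC₁, H⟩ := h q hq
  have hq0 : 0 < q := by linarith
  -- the scaling parameters
  set c : ℝ := min 1 (Real.sqrt ν) with hc
  have hc0 : 0 < c := lt_min one_pos (Real.sqrt_pos.2 hν)
  have hc1 : c ≤ 1 := min_le_left _ _
  have hc2 : c ^ 2 ≤ ν := by
    have h1 : c ≤ Real.sqrt ν := min_le_right _ _
    calc c ^ 2 ≤ (Real.sqrt ν) ^ 2 := pow_le_pow_left₀ hc0.le h1 2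
      _ = ν := Real.sq_sqrt hν.le
  set α : ℝ := c / ν with hα
  set β : ℝ := α * c with hβ
  have hα0 : 0 < α := by positivity
  have hγ0 : 0 < c := hc0
  have hβ0 : 0 < β := by positivity
  have hβ1 : β ≤ 1 := by
    rw [hβ, hα, div_mul_eq_mul_div, div_le_one hν]; nlinarith
  -- the constants
  set J : ℝ := β * c ^ 3 with hJ
  have hJ0 : 0 < J := by positivity
  set K₁ : ℝ := (α ^ 3 / J) ^ (1 / 3 : ℝ) with hK₁
  set K₂ : ℝ := ((α ^ 2 * c) ^ q / J) ^ (1 / (2 * q)) with hK₂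
  set K : ℝ := max K₁ K₂ with hK
  have hK₁0 : 0 < K₁ := Real.rpow_pos_of_pos (by positivity) _
  have hK0 : 0 < K := lt_max_of_lt_left hK₁0
  have hK3 : α ^ 3 / J ≤ K ^ 3 := by
    have : K₁ ^ 3 = α ^ 3 / J := by
      rw [hK₁, ← Real.rpow_natCast, ← Real.rpow_mul (by positivity)]; norm_num
    rw [← this]
    exact pow_le_pow_left₀ hK₁0.le (le_max_left _ _) 3
  have hK2q : (α ^ 2 * c) ^ q / J ≤ K ^ (2 * q) := by
    have hK₂0 : 0 ≤ K₂ := Real.rpow_nonneg (by positivity) _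
    have : K₂ ^ (2 * q) = (α ^ 2 * c) ^ q / J := by
      rw [hK₂, ← Real.rpow_mul (by positivity), one_div_mul_cancel (by positivity),
        Real.rpow_one]
    rw [← this]
    exact Real.rpow_le_rpow hK₂0 (le_max_right _ _) (by positivity)
  refine ⟨ε₁ / K, C₁ * K / α, div_pos hε₁ hK0, by positivity, ?_⟩
  intro Ω f u p G hS l hsub hl hlε hUP hF
  -- the rescaled datum, of viscosity `1`
  have hS' := hS.stRescale hα0 hγ0 hβ.symm.symm 0 0
  have e1 : α * ν / c = 1 := by rw [hα]; field_simp
  rw [e1] at hS'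
  set Φ := stAffine β c 0 (0 : EuclideanSpace ℝ (Fin 3)) with hΦ
  -- the slab `Φ⁻¹(Q_1(0))`
  have hslab : Φ ⁻¹' parabolicCylinder 1 (0 : ℝ × EuclideanSpace ℝ (Fin 3)) =
      Ioo (-1 / β) 0 ×ˢ ball (0 : EuclideanSpace ℝ (Fin 3)) (1 / c) := by
    rw [parabolicCylinder, hΦ, stAffine_preimage_cylinder hβ0 hγ0]
    simp only [Prod.fst_zero, Prod.snd_zero, one_pow, zero_sub, sub_zero, zero_div, smul_zero]
  have htarget : Φ ⁻¹' parabolicCylinder (1 / 2) (0 : ℝ × EuclideanSpace ℝ (Fin 3)) =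
      Ioo (-(1 / 2) ^ 2 / β) 0 ×ˢ ball (0 : EuclideanSpace ℝ (Fin 3)) (1 / 2 / c) := by
    rw [parabolicCylinder, hΦ, stAffine_preimage_cylinder hβ0 hγ0]
    simp only [Prod.fst_zero, Prod.snd_zero, zero_sub, sub_zero, zero_div, smul_zero]
  -- Jacobian
  have hJac : ENNReal.ofReal (β * c ^ Module.finrank ℝ (EuclideanSpace ℝ (Fin 3)))⁻¹ =
      ENNReal.ofReal J⁻¹ := by
    rw [finrank_euclideanSpace_three]
  -- smallness on the slab
  set u' := α • stPull β c 0 (0 : EuclideanSpace ℝ (Fin 3)) u with hu'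
  set p' := α ^ 2 • stPull β c 0 (0 : EuclideanSpace ℝ (Fin 3)) p with hp'
  set f' := (α ^ 2 * c) • stPull β c 0 (0 : EuclideanSpace ℝ (Fin 3)) f with hf'
  have hUP' : ∫⁻ w in Φ ⁻¹' parabolicCylinder 1 (0 : ℝ × EuclideanSpace ℝ (Fin 3)),
      (‖u' w.1 w.2‖ₑ ^ (3 : ℕ) + ‖p' w.1 w.2‖ₑ ^ (3 / 2 : ℝ)) ≤ ENNReal.ofReal ((K * l) ^ 3) := by
    set Fs : ℝ × EuclideanSpace ℝ (Fin 3) → ℝ≥0∞ := fun z =>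
      ‖u z.1 z.2‖ₑ ^ (3 : ℕ) + ‖p z.1 z.2‖ₑ ^ (3 / 2 : ℝ) with hFs
    have hpt : ∀ w : ℝ × EuclideanSpace ℝ (Fin 3),
        ‖u' w.1 w.2‖ₑ ^ (3 : ℕ) + ‖p' w.1 w.2‖ₑ ^ (3 / 2 : ℝ) = ENNReal.ofReal (α ^ 3) * Fs (Φ w) := by
      intro w
      rw [hu', hp', smul_stPull_apply, smul_stPull_apply, enorm_smul, enorm_smul, mul_pow,
        ENNReal.mul_rpow_of_nonneg _ _ (by norm_num), Real.enorm_eq_ofReal hα0.le,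
        Real.enorm_eq_ofReal (by positivity : (0:ℝ) ≤ α ^ 2), ← ENNReal.ofReal_pow hα0.le,
        ENNReal.ofReal_rpow_of_nonneg (by positivity) (by norm_num), sq_rpow_three_halves' hα0.le,
        hFs, mul_add]
      rfl
    simp_rw [hpt]
    rw [lintegral_const_mul' _ _ ENNReal.ofReal_ne_top, hΦ,
      setLIntegral_preimage_comp_stAffine hβ0 hγ0 0 0 Fs, hJac]
    calc ENNReal.ofReal (α ^ 3) * (ENNReal.ofReal J⁻¹ *
          ∫⁻ z in parabolicCylinder 1 (0 : ℝ × EuclideanSpace ℝ (Fin 3)), Fs z)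
        ≤ ENNReal.ofReal (α ^ 3) * (ENNReal.ofReal J⁻¹ * ENNReal.ofReal (l ^ 3)) := by gcongr
      _ = ENNReal.ofReal (α ^ 3 / J * l ^ 3) := by
          rw [← ENNReal.ofReal_mul (by positivity), ← ENNReal.ofReal_mul (by positivity)]
          exact congrArg ENNReal.ofReal (by rw [div_eq_mul_inv, mul_assoc])
      _ ≤ ENNReal.ofReal ((K * l) ^ 3) := by
          refine ENNReal.ofReal_le_ofReal ?_
          rw [mul_pow]
          exact mul_le_mul_of_nonneg_right hK3 (pow_nonneg hl 3)
  have hF' : ∫⁻ w in Φ ⁻¹' parabolicCylinder 1 (0 : ℝ × EuclideanSpace ℝ (Fin 3)),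
      ‖f' w.1 w.2‖ₑ ^ q ≤ ENNReal.ofReal ((K * l) ^ (2 * q)) := by
    rw [hf', hΦ, setLIntegral_enorm_rpow_stRescale hβ0 hγ0 0 0 (α ^ 2 * c) f _ hq0.le, hJac,
      Real.enorm_eq_ofReal (by positivity), ENNReal.ofReal_rpow_of_nonneg (by positivity) hq0.le]
    calc ENNReal.ofReal ((α ^ 2 * c) ^ q) * ENNReal.ofReal J⁻¹ *
          ∫⁻ z in parabolicCylinder 1 (0 : ℝ × EuclideanSpace ℝ (Fin 3)), ‖f z.1 z.2‖ₑ ^ q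
        ≤ ENNReal.ofReal ((α ^ 2 * c) ^ q) * ENNReal.ofReal J⁻¹ * ENNReal.ofReal (l ^ (2 * q)) := by
          gcongr
      _ = ENNReal.ofReal ((α ^ 2 * c) ^ q / J * l ^ (2 * q)) := by
          rw [← ENNReal.ofReal_mul (by positivity), ← ENNReal.ofReal_mul (by positivity),
            div_eq_mul_inv]
      _ ≤ ENNReal.ofReal ((K * l) ^ (2 * q)) := by
          refine ENNReal.ofReal_le_ofReal ?_
          rw [Real.mul_rpow hK0.le hl]
          exact mul_le_mul_of_nonneg_right hK2q (Real.rpow_nonneg hl _)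
  -- the bound on every admissible unit cylinder of the slab
  have hl' : 0 ≤ K * l := by positivity
  have hl'ε : K * l ≤ ε₁ := by
    rw [le_div_iff₀ hK0] at hlε; linarith
  have hpiece : ∀ z' : ℝ × EuclideanSpace ℝ (Fin 3),
      parabolicCylinder 1 z' ⊆ Φ ⁻¹' parabolicCylinder 1 (0 : ℝ × EuclideanSpace ℝ (Fin 3)) →
      ∀ᵐ w ∂(volume.restrict (parabolicCylinder (1 / 2) z')),
        ‖u (Φ w).1 (Φ w).2‖ ≤ C₁ * K / α * l := by
    intro z' hz'
    have hsub' : parabolicCylinder 1 z' ⊆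
        ((stPreimage β c 0 (0 : EuclideanSpace ℝ (Fin 3)) Ω : Opens _) : Set _) := by
      rw [coe_stPreimage]
      exact hz'.trans (preimage_mono hsub)
    have h1 := H _ _ _ _ _ hS' z' (K * l) hsub' hl' hl'ε
      ((lintegral_mono_set hz').trans hUP') ((lintegral_mono_set hz').trans hF')
    filter_upwards [h1] with w hw
    have e : ‖u' w.1 w.2‖ = α * ‖u (Φ w).1 (Φ w).2‖ := by
      rw [hu', smul_stPull_apply, norm_smul, Real.norm_eq_abs, abs_of_pos hα0]
      rfl
    rw [e] at hw
    rw [div_mul_eq_mul_div, le_div_iff₀ hα0]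
    linarith
  -- the countable covering of the target
  classical
  obtain ⟨D₀, hD₀c, hD₀d⟩ := TopologicalSpace.exists_countable_dense (EuclideanSpace ℝ (Fin 3))
  set D : Set (EuclideanSpace ℝ (Fin 3)) := insert 0 D₀ with hD
  have hDc : D.Countable := hD₀c.insert 0
  haveI : Countable D := hDc.to_subtype
  set piece : ℚ × D → Set (ℝ × EuclideanSpace ℝ (Fin 3)) := fun i =>
    if parabolicCylinder 1 ((i.1 : ℝ), (i.2 : EuclideanSpace ℝ (Fin 3))) ⊆
        Φ ⁻¹' parabolicCylinder 1 (0 : ℝ × EuclideanSpace ℝ (Fin 3))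
    then parabolicCylinder (1 / 2) ((i.1 : ℝ), (i.2 : EuclideanSpace ℝ (Fin 3))) else ∅
    with hpiece_def
  have hcover : Φ ⁻¹' parabolicCylinder (1 / 2) (0 : ℝ × EuclideanSpace ℝ (Fin 3)) ⊆
      ⋃ i, piece i := by
    rintro ⟨s, y⟩ hw
    rw [htarget, mem_prod, mem_Ioo, mem_ball, dist_zero_right] at hw
    obtain ⟨⟨hs1, hs2⟩, hy⟩ := hw
    dsimp only at hs1 hs2 hy
    -- time centre
    have hβinv : 1 ≤ 1 / β := by rw [le_div_iff₀ hβ0]; linarith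
    obtain ⟨s', hs'Q, hs'1, hs'2, hs'3⟩ : ∃ s' : ℚ, True ∧ 1 - 1 / β ≤ (s' : ℝ) ∧ (s' : ℝ) ≤ 0 ∧
        s ∈ Ioo ((s' : ℝ) - (1 / 2) ^ 2) (s' : ℝ) := by
      by_cases hs : -(1 / 2) ^ 2 < s
      · exact ⟨0, trivial, by push_cast; linarith, by push_cast; exact le_rfl,
          by push_cast; exact ⟨by linarith, hs2⟩⟩
      · have hs' : s ≤ -(1 / 2) ^ 2 := not_lt.1 hs
        have hlo : max s (1 - 1 / β) < s + (1 / 2) ^ 2 := by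
          refine max_lt (by norm_num) ?_
          have h1 : -(1 / 2) ^ 2 / β < s := hs1
          rw [div_lt_iff₀ hβ0] at h1
          have h2 : (3 / 4 - s) * β < 1 := by nlinarith
          have h3 : 3 / 4 - s < 1 / β := by rwa [lt_div_iff₀ hβ0]
          linarith
        obtain ⟨s', h1, h2⟩ := exists_rat_btwn hlo
        refine ⟨s', trivial, ((le_max_right _ _).trans_lt h1).le, ?_, ?_⟩
        · linarith
        · exact ⟨by linarith, (le_max_left _ _).trans_lt h1⟩
    -- space centre
    have hy' : ‖y‖ < 1 / (2 * c) := by rw [← div_div]; exact hy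
    obtain ⟨a, haD, ha1, ha2⟩ := exists_center_of_norm_lt hc0 hc1 hD₀d hy'
    have haD' : a ∈ D := by
      rcases haD with h | h
      · exact mem_insert_of_mem _ h
      · rw [h]; exact mem_insert _ _
    refine mem_iUnion.2 ⟨(s', ⟨a, haD'⟩), ?_⟩
    have hadm : parabolicCylinder 1 ((s' : ℝ), a) ⊆
        Φ ⁻¹' parabolicCylinder 1 (0 : ℝ × EuclideanSpace ℝ (Fin 3)) := by
      rw [hslab]
      rintro ⟨t, x⟩ htx
      rw [mem_parabolicCylinder] at htx
      obtain ⟨⟨ht1, ht2⟩, hx⟩ := htx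
      refine ⟨⟨?_, by linarith⟩, ?_⟩
      · have : -1 / β = -(1 / β) := by ring
        rw [this]; linarith
      · rw [mem_ball, dist_zero_right]
        calc ‖x‖ = dist x 0 := (dist_zero_right x).symm
          _ ≤ dist x a + dist a 0 := dist_triangle _ _ _
          _ < 1 + ‖a‖ := by rw [dist_zero_right]; linarith
          _ ≤ 1 / c := by linarith
    have hpi : piece (s', ⟨a, haD'⟩) = parabolicCylinder (1 / 2) ((s' : ℝ), a) := by
      simp only [hpiece_def]; exact if_pos hadm
    rw [hpi, mem_parabolicCylinder]
    exact ⟨hs'3, by rw [dist_eq_norm]; exact ha2⟩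
  have hall : ∀ᵐ w ∂(volume.restrict (⋃ i, piece i)), ‖u (Φ w).1 (Φ w).2‖ ≤ C₁ * K / α * l := by
    rw [ae_restrict_iUnion_iff]
    intro i
    by_cases hadm : parabolicCylinder 1 ((i.1 : ℝ), (i.2 : EuclideanSpace ℝ (Fin 3))) ⊆
        Φ ⁻¹' parabolicCylinder 1 (0 : ℝ × EuclideanSpace ℝ (Fin 3))
    · have hpi : piece i = parabolicCylinder (1 / 2) ((i.1 : ℝ), (i.2 : EuclideanSpace ℝ (Fin 3))) := by
        simp only [hpiece_def]; exact if_pos hadm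
      rw [hpi]
      exact hpiece _ hadm
    · have hpi : piece i = ∅ := by simp only [hpiece_def]; exact if_neg hadm
      rw [hpi, Measure.restrict_empty, ae_zero]
      exact eventually_bot
  have htar : ∀ᵐ w ∂(volume.restrict (Φ ⁻¹' parabolicCylinder (1 / 2) (0 : ℝ × EuclideanSpace ℝ (Fin 3)))),
      ‖u (Φ w).1 (Φ w).2‖ ≤ C₁ * K / α * l :=
    ae_restrict_of_ae_restrict_of_subset hcover hall
  -- back along `Φ`
  have key := ae_restrict_of_ae_restrict_preimage_stAffine hβ0 hγ0 0 (0 : EuclideanSpace ℝ (Fin 3))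
    (S := parabolicCylinder (1 / 2) (0 : ℝ × EuclideanSpace ℝ (Fin 3)))
    (P := fun z => ‖u z.1 z.2‖ ≤ C₁ * K / α * l) htar
  exact key

end Literature.Analysis.FluidPDE
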